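import Mathlib
import Summits.Ventures.PercRepro2.TypedSepThreeSort

/-!
# The typed (SEP-2) zero, I (a₃ on the b-side): the gluing and the doubly symmetrised kernel
(blind cell PercRepro2, p3 g6, 2026-08-25; `proofs/P3-BRIDGE.md` §11.22)

The doors are the ROOTS `a₁, a₂`: the o-side holds `o` alone (side state `(a₁~o, a₂~o, a₁~a₂)`
inside it, the type `SepThree.OSt`), the b-side holds `a₃` and `b` (side state `SepThree.BSt`).
The glued state `glued2` is the raw output of the two-door closure lemmas; the `S₃ × S₃`-symmetrised
kernel `dsym2` VANISHES IDENTICALLY on valid states (`dsym2_eq_zero`) — the typed shadow of the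
lead's (SEP-2) identity («{a₁, a₂} separates o from b ⟹ Gc ≡ 0», LEAD-CYCLES §4, paper), by the
mechanism of the typed (SEP-3) zero: an identity across the separator, then a pointwise `decide`.
Own work; standard axioms.
-/

namespace Summit.Ventures.PercRepro2

namespace CovForm

namespace SepTwo

open OneTyped SepThree

/-! ## The gluing with the doors `a₁, a₂` and `a₃` on the b-side -/

/-- **The glued state** of a copy from its o-side state `(l, h, X) = (a₁~o, a₂~o, a₁~a₂)` and its
b-side state `(h₁₂, h₃₂, Y, b₁, b₂, b₃)`: with `D = X ∨ h₁₂` (`a₁ ~ a₂`), `a₁~a₃ = Y ∨ (D ∧ (h₃₂ ∨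
(h₁₂ ∧ Y)))`, `a₂~a₃ = h₃₂ ∨ (D ∧ ((h₁₂ ∧ h₃₂) ∨ Y))`, `a₁~b = b₁ ∨ (D ∧ (b₂ ∨ (h₁₂ ∧ b₁)))`,
`a₂~b = b₂ ∨ (D ∧ ((h₁₂ ∧ b₂) ∨ b₁))`, `a₁~o = l ∨ (D ∧ (h ∨ (X ∧ l)))`,
`a₂~o = h ∨ (D ∧ ((X ∧ h) ∨ l))`. -/
def glued2 (s : OSt) (t : BSt) : St :=
  let l := s.1
  let hh := s.2.1
  let X := s.2.2
  let h12 := t.1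
  let h32 := t.2.1
  let Y := t.2.2.1
  let b1 := t.2.2.2.1
  let b2 := t.2.2.2.2.1
  let D := X || h12
  (D, l || (D && (hh || (X && l))), hh || (D && ((X && hh) || l)),
    b1 || (D && (b2 || (h12 && b1))), b2 || (D && ((h12 && b2) || b1)),
    Y || (D && (h32 || (h12 && Y))), h32 || (D && ((h12 && h32) || Y)))

/-- The kernel on glued state triples. -/
def psi2 (x y w : OSt) (u v r : BSt) : ℤ := KB (glued2 x u) (glued2 y v) (glued2 w r)

/-- **The doubly symmetrised kernel** (36 terms: the o-states and the b-states permuted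
independently). -/
def dsym2 (x y w : OSt) (u v r : BSt) : ℤ :=
  (psi2 x y w u v r + psi2 x y w u r v + psi2 x y w v u r + psi2 x y w v r u + psi2 x y w r u v +
      psi2 x y w r v u) +
  (psi2 x w y u v r + psi2 x w y u r v + psi2 x w y v u r + psi2 x w y v r u + psi2 x w y r u v +
      psi2 x w y r v u) +
  (psi2 y x w u v r + psi2 y x w u r v + psi2 y x w v u r + psi2 y x w v r u + psi2 y x w r u v +
      psi2 y x w r v u) +
  (psi2 y w x u v r + psi2 y w x u r v + psi2 y w x v u r + psi2 y w x v r u + psi2 y w x r u v +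
      psi2 y w x r v u) +
  (psi2 w x y u v r + psi2 w x y u r v + psi2 w x y v u r + psi2 w x y v r u + psi2 w x y r u v +
      psi2 w x y r v u) +
  (psi2 w y x u v r + psi2 w y x u r v + psi2 w y x v u r + psi2 w y x v r u + psi2 w y x r u v +
      psi2 w y x r v u)

/-- `dsym2` is symmetric in the first two o-states. -/
lemma dsym2_swapO12 (x y w : OSt) (u v r : BSt) : dsym2 x y w u v r = dsym2 y x w u v r := by
  unfold dsym2; ring

/-- `dsym2` is symmetric in the last two o-states. -/
lemma dsym2_swapO23 (x y w : OSt) (u v r : BSt) : dsym2 x y w u v r = dsym2 x w y u v r := by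
  unfold dsym2; ring

/-- `dsym2` is symmetric in the first two b-states. -/
lemma dsym2_swapB12 (x y w : OSt) (u v r : BSt) : dsym2 x y w u v r = dsym2 x y w v u r := by
  unfold dsym2; ring

/-- `dsym2` is symmetric in the last two b-states. -/
lemma dsym2_swapB23 (x y w : OSt) (u v r : BSt) : dsym2 x y w u v r = dsym2 x y w u r v := by
  unfold dsym2; ring

/-- `dsym2` is unchanged by sorting the o-states. -/
lemma dsym2_sort3O (x y w : OSt) (u v r : BSt) :
    dsym2 x y w u v r = dsym2 (sort3O x y w).1 (sort3O x y w).2.1 (sort3O x y w).2.2 u v r := by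
  unfold sort3O
  split_ifs <;> dsimp only <;>
    first
    | rfl
    | exact dsym2_swapO12 x y w u v r
    | exact dsym2_swapO23 x y w u v r
    | exact (dsym2_swapO12 x y w u v r).trans (dsym2_swapO23 y x w u v r)
    | exact (dsym2_swapO23 x y w u v r).trans (dsym2_swapO12 x w y u v r)
    | exact ((dsym2_swapO12 x y w u v r).trans (dsym2_swapO23 y x w u v r)).trans
        (dsym2_swapO12 y w x u v r)

/-- `dsym2` is unchanged by sorting the b-states. -/
lemma dsym2_sort3B (x y w : OSt) (u v r : BSt) :
    dsym2 x y w u v r = dsym2 x y w (sort3B u v r).1 (sort3B u v r).2.1 (sort3B u v r).2.2 := by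
  unfold sort3B
  split_ifs <;> dsimp only <;>
    first
    | rfl
    | exact dsym2_swapB12 x y w u v r
    | exact dsym2_swapB23 x y w u v r
    | exact (dsym2_swapB12 x y w u v r).trans (dsym2_swapB23 x y w v u r)
    | exact (dsym2_swapB23 x y w u v r).trans (dsym2_swapB12 x y w u r v)
    | exact ((dsym2_swapB12 x y w u v r).trans (dsym2_swapB23 x y w v u r)).trans
        (dsym2_swapB12 x y w v r u)

/-! ## The vanishing on the sorted representatives -/

/-- The vanishing for a fixed sorted o-triple, over the sorted b-triples. -/
def allZeroAt2 (x y w : OSt) : Bool :=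
  bList.all fun u => (bSorted u).all fun v => (bSorted v).all fun r =>
    decide (dsym2 x y w u v r = 0)

/-- Slice 0: three sorted o-triples. -/
theorem allZeroAt2_0 :
    (allZeroAt2 (false, false, false) (false, false, false) (false, false, false) &&
      allZeroAt2 (false, false, false) (false, false, false) (false, false, true) &&
      allZeroAt2 (false, false, false) (false, false, false) (false, true, false)) = true := by
  decide +kernel
/-- Slice 1: three sorted o-triples. -/
theorem allZeroAt2_1 :
    (allZeroAt2 (false, false, false) (false, false, false) (true, false, false) &&
      allZeroAt2 (false, false, false) (false, false, false) (true, true, true) &&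
      allZeroAt2 (false, false, false) (false, false, true) (false, false, true)) = true := by
  decide +kernel
/-- Slice 2: three sorted o-triples. -/
theorem allZeroAt2_2 :
    (allZeroAt2 (false, false, false) (false, false, true) (false, true, false) &&
      allZeroAt2 (false, false, false) (false, false, true) (true, false, false) &&
      allZeroAt2 (false, false, false) (false, false, true) (true, true, true)) = true := by
  decide +kernel
/-- Slice 3: three sorted o-triples. -/
theorem allZeroAt2_3 :
    (allZeroAt2 (false, false, false) (false, true, false) (false, true, false) &&
      allZeroAt2 (false, false, false) (false, true, false) (true, false, false) &&
      allZeroAt2 (false, false, false) (false, true, false) (true, true, true)) = true := by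
  decide +kernel
/-- Slice 4: three sorted o-triples. -/
theorem allZeroAt2_4 :
    (allZeroAt2 (false, false, false) (true, false, false) (true, false, false) &&
      allZeroAt2 (false, false, false) (true, false, false) (true, true, true) &&
      allZeroAt2 (false, false, false) (true, true, true) (true, true, true)) = true := by
  decide +kernel
/-- Slice 5: three sorted o-triples. -/
theorem allZeroAt2_5 :
    (allZeroAt2 (false, false, true) (false, false, true) (false, false, true) &&
      allZeroAt2 (false, false, true) (false, false, true) (false, true, false) &&
      allZeroAt2 (false, false, true) (false, false, true) (true, false, false)) = true := by
  decide +kernel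
/-- Slice 6: three sorted o-triples. -/
theorem allZeroAt2_6 :
    (allZeroAt2 (false, false, true) (false, false, true) (true, true, true) &&
      allZeroAt2 (false, false, true) (false, true, false) (false, true, false) &&
      allZeroAt2 (false, false, true) (false, true, false) (true, false, false)) = true := by
  decide +kernel
/-- Slice 7: three sorted o-triples. -/
theorem allZeroAt2_7 :
    (allZeroAt2 (false, false, true) (false, true, false) (true, true, true) &&
      allZeroAt2 (false, false, true) (true, false, false) (true, false, false) &&
      allZeroAt2 (false, false, true) (true, false, false) (true, true, true)) = true := by
  decide +kernel
/-- Slice 8: three sorted o-triples. -/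
theorem allZeroAt2_8 :
    (allZeroAt2 (false, false, true) (true, true, true) (true, true, true) &&
      allZeroAt2 (false, true, false) (false, true, false) (false, true, false) &&
      allZeroAt2 (false, true, false) (false, true, false) (true, false, false)) = true := by
  decide +kernel
/-- Slice 9: three sorted o-triples. -/
theorem allZeroAt2_9 :
    (allZeroAt2 (false, true, false) (false, true, false) (true, true, true) &&
      allZeroAt2 (false, true, false) (true, false, false) (true, false, false) &&
      allZeroAt2 (false, true, false) (true, false, false) (true, true, true)) = true := by
  decide +kernel
/-- Slice 10: three sorted o-triples. -/
theorem allZeroAt2_10 :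
    (allZeroAt2 (false, true, false) (true, true, true) (true, true, true) &&
      allZeroAt2 (true, false, false) (true, false, false) (true, false, false) &&
      allZeroAt2 (true, false, false) (true, false, false) (true, true, true)) = true := by
  decide +kernel
/-- Slice 11: three sorted o-triples. -/
theorem allZeroAt2_11 :
    (allZeroAt2 (true, false, false) (true, true, true) (true, true, true) &&
      allZeroAt2 (true, true, true) (true, true, true) (true, true, true)) = true := by
  decide +kernel

/-- The vanishing on the sorted representatives as a Boolean computation (12 slices). -/
theorem dsym2_zero_all : (oTriples.all fun s => allZeroAt2 s.1 s.2.1 s.2.2) = true := by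
  rw [oTriples_eq]
  simp only [List.all_cons, List.all_nil, Bool.and_true, Bool.and_eq_true]
  have h0 := and3 allZeroAt2_0
  have h1 := and3 allZeroAt2_1
  have h2 := and3 allZeroAt2_2
  have h3 := and3 allZeroAt2_3
  have h4 := and3 allZeroAt2_4
  have h5 := and3 allZeroAt2_5
  have h6 := and3 allZeroAt2_6
  have h7 := and3 allZeroAt2_7
  have h8 := and3 allZeroAt2_8
  have h9 := and3 allZeroAt2_9
  have h10 := and3 allZeroAt2_10
  have h11 := (Bool.and_eq_true _ _).mp allZeroAt2_11
  exact ⟨h0.1, h0.2.1, h0.2.2, h1.1, h1.2.1, h1.2.2, h2.1, h2.2.1, h2.2.2,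
    h3.1, h3.2.1, h3.2.2, h4.1, h4.2.1, h4.2.2, h5.1, h5.2.1, h5.2.2,
    h6.1, h6.2.1, h6.2.2, h7.1, h7.2.1, h7.2.2, h8.1, h8.2.1, h8.2.2,
    h9.1, h9.2.1, h9.2.2, h10.1, h10.2.1, h10.2.2, h11.1, h11.2⟩

/-- **The doubly symmetrised kernel vanishes on every sorted pair of valid triples.** -/
theorem dsym2_zero_sorted : ∀ s ∈ oTriples, ∀ t ∈ bTriples,
    dsym2 s.1 s.2.1 s.2.2 t.1 t.2.1 t.2.2 = 0 := by
  rintro ⟨x, y, w⟩ hs ⟨u, v, r⟩ ht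
  rw [mem_oTriples] at hs
  rw [mem_bTriples] at ht
  have key := dsym2_zero_all
  simp only [List.all_eq_true] at key
  have h := key (x, y, w) (mem_oTriples.2 hs)
  simp only [allZeroAt2, bSorted, List.all_eq_true, decide_eq_true_eq, List.mem_filter] at h
  exact h u ht.1.1 v ⟨ht.1.2.1, ht.2.1⟩ r ⟨ht.1.2.2, ht.2.2⟩

/-- **THE DOUBLY SYMMETRISED KERNEL VANISHES IDENTICALLY on valid states.** -/
theorem dsym2_eq_zero (x y w : OSt) (u v r : BSt) (hx : ValidO x = true) (hy : ValidO y = true)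
    (hw : ValidO w = true) (hu : ValidB u = true) (hv : ValidB v = true) (hr : ValidB r = true) :
    dsym2 x y w u v r = 0 := by
  rw [dsym2_sort3O, dsym2_sort3B]
  exact dsym2_zero_sorted _ (sort3O_mem x y w hx hy hw) _ (sort3B_mem u v r hu hv hr)

end SepTwo

end CovForm

end Summit.Ventures.PercRepro2
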